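import Mathlib.MeasureTheory.Integral.IntervalIntegral.FundThmCalculus
import Literature.Geometry.Lorentzian.BondiMass
import Literature.Geometry.Lorentzian.Causality
import HarnessLib

/-!
# Energy flux through a foliated timelike tube (Hawking-mass flux)

Let `(M, g, τ)` be a time-oriented Lorentzian manifold (meant: `dim M = 4`) and `𝒯 ≅ ℝ × S` a
*timelike tube*: the image of an embedding `F : ℝ × S → M` of the cylinder over a closed surface
`S` whose leaves `S_t = F(t, ·)` are spacelike `2`-surfaces and whose flow lines `t ↦ F(t, y)` are
future-directed timelike curves (Brown–York's timelike boundary `³B` foliated by `Σ_t = ∂Ω_t`,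
Wang–Yau, PRL 102 (2009) 021101, §2; a flow of spacelike `2`-surfaces `Φ : Ŝ × I → V` with
timelike flow vector, Bray–Hayward–Mars–Simon (BHMS), CMP 272 (2007), §2). The **Hawking-mass
(Hawking-energy) flux** through the portion `𝒯_{[t₁, t₂]} = F([t₁, t₂] × S)` is

  `Φ(t₁, t₂) := m_H(S_{t₁}) - m_H(S_{t₂}) = -∫_{t₁}^{t₂} (d/dt) m_H(S_t) dt`,

the net quasi-local (Hawking) energy radiated outward through `𝒯` between the two cuts, where
`m_H(S) = √(|S|/16π) (1 + (16π)⁻¹ ∫_S θ_L θ_L̲ dA)` is the Hawking mass (`hawkingMass` of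
`BondiMass.lean`; Hawking, J. Math. Phys. 9 (1968) 598). The *density* of the integrand — the
variation of `m_H` along an arbitrary flow of spacelike `2`-surfaces in a `4`-dimensional
spacetime: an integral over `S_t` of the Einstein tensor `G(H⃗^⋆, ξ⃗^⋆)`, the "Hawking energy
density" `Ω` and the effective gravitational-radiation tensors `Θ^T` (null shears `|σ_±|²/32π`),
`Θ^L` (normal fundamental forms `|ζ|²/8π`) — is BHMS 2007, Lemma 3, with monotonicity along
uniformly expanding flows under the dominant energy condition (Thm 1); Hayward, PRL 93 (2004)
251101 writes the integrated law `[E] = ∫_H (T(χ, τ) + Θ(χ, τ)) d²A dx` and notes that the flux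
"reduces to the Bondi flux at null infinity". Since the Hawking masses of cuts receding to `𝓘⁺`
tend to the Bondi mass (Hayward, PRD 49 (1994) 831, §5, `M_B = lim M_H`; Christodoulou–Klainerman
1993, Ch. 17, 17.0.3), the flux of such tubes tends to the Bondi–Trautman mass loss
`M_B(u₁) - M_B(u₂) ≥ 0` (CK 1993, 17.0.8) — here the proved, foliation-agnostic `tendsto_energyFlux`.

## Main definitions (`namespace Literature.Geometry.Lorentzian`)

* `LorentzianMetric.hawkingMassFormula A J = √(A/16π) (1 + J/16π)`, with
  `hawkingMass_eq_hawkingMassFormula` (`rfl`) and the **scale covariance**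
  `hawkingMassFormula_sq_mul : hawkingMassFormula (c² A) J = c · hawkingMassFormula A J`: under
  `g ↦ c² g` (and `(L, L̲) ↦ (c⁻¹ L, c⁻¹ L̲)` to keep `g(L, L̲) = -2`) areas scale by `c²` and
  `θ_L θ_L̲ dA` is invariant, so `m_H ↦ c m_H` and `Φ ↦ c Φ` — the flux is an energy (a length).
* `LorentzianMetric.TimelikeTube g τ` — hypothesis structure (surface type `surf` with its seven
  instances as fields, as in `BondiFoliation`; leaves `leaf : ℝ → surf → M`; the tube map a smooth
  embedding of `ℝ × surf`; leaves smoothly embedded spacelike immersions; flow lines future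
  timelike; a null normal pair `pair t` per leaf), with `map`, `portion t₁ t₂ = F([t₁, t₂] × surf)`,
  `leafMetric`, `leafArea`, `leafHawkingMass t = m_H(S_t)`, `energyFlux t₁ t₂`.
* `timelikeTubeEnergyFlux 𝓢 𝓣 t₁ t₂` — the same for `𝓢 : Spacetime 4` (the form requested by route
  `FinalStateConjecture/ConcentrationCannotWait`, items NL/K3).
* API (all proved): `energyFlux_self`, `energyFlux_add_energyFlux` (additivity under
  concatenation), `energyFlux_symm`, `leafHawkingMass_sub_eq_neg_energyFlux` (the balance law
  (P2) for the Hawking mass, exact), `energyFlux_eq_neg_intervalIntegral` (`Φ = -∫ ṁ_H`, FTC),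
  `energyFlux_nonneg_iff`, `energyFlux_nonneg_of_antitoneOn`, `tendsto_energyFlux` ((P1)).

## Mathlib

Mathlib (at the pin) has no Lorentzian geometry, Hawking mass or quasi-local energy
(`rg -i 'hawking|quasi.?local|bondi' Mathlib` is empty). We use `Manifold.IsSmoothEmbedding` on the
product manifold `ℝ × surf` (model `𝓘(ℝ, ℝ).prod (𝓡 2)`), `intervalIntegral.integral_eq_sub_of_hasDerivAt`,
`Filter.Tendsto.sub`, `Real.sqrt_mul`; everything geometric comes from `BondiMass` (`hawkingMass`),
`TrappedSurface` (`NullNormalPair`, `nullExpansion`), `Hypersurface` (`IsSpacelikeImmersion`,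
`inducedRiemannianMetric`), `Volume` (`totalArea`), `Causality` (`IsFutureTimelikeCurveOn`).

## Design choices

* *Which quasi-local energy.* Of (a) the Wang–Yau energy (an infimum over isometric embeddings of
  `S_t` into `ℝ^{3,1}` and observers, Wang–Yau, CMP 288 (2009) 919; PRL 102 (2009) 021101, Def. 2),
  (b) the Hawking-mass flux, (c) Brown–York / Liu–Yau (reference term `k₀` from the Weyl embedding
  into `ℝ³`), only (b) is expressible over the tree: (a), (c) need the mean curvature vector, the
  normal connection and isometric embeddings into flat space, none of which is vendored.
  `-- TODO(general form): Wang–Yau quasi-local energy-momentum and its flux (WangYau2009, §5).`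
* *Flux = minus the increment of the quasi-local mass.* For any quasi-local mass the energy
  radiated through a tube portion is the decrement of the mass between the bounding cuts (Hayward
  2004: `[E]`, "the change in `E` ... from one ... surface to another", equals the integrated
  flux); the density representation (BHMS Lemma 3) is a theorem about `t ↦ m_H(S_t)`, recorded only
  as the FTC identity `energyFlux_eq_neg_intervalIntegral` for a supplied derivative. Sign: `Φ > 0`
  is net *outgoing* energy (mass loss), increasing `t` = future (`isFutureTimelike`). `Φ` is a net
  flux and has no sign in general: positivity holds along flows on which `m_H` is monotone (BHMS
  Thm 1; hypothesis form `energyFlux_nonneg_of_antitoneOn`) and asymptotically at `𝓘⁺`.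
* *The null normal pair is data.* `hawkingMass` needs a null normal pair of each leaf;
  `TimelikeTube` carries one per leaf as a field (as `BondiFoliation` does), unrelated to the tube.
  This is harmless: in codimension two null normal pairs differ pointwise by a boost
  `(L, L̲) ↦ (a L, a⁻¹ L̲)`, `a > 0`, and/or the swap, and `χ_{aL} = a χ_L` (`L ⊥ df`), so
  `θ_{aL} θ_{a⁻¹L̲} = θ_L θ_L̲` and `m_H(S_t)` depends on the leaf only (`hawkingMass_swap` is the
  proved half of this remark). With `u` the future unit normal of `S_t` in `𝒯` and `n` the outward
  unit normal of `𝒯`, `L = u + n`, `L̲ = u - n` gives `θ_L θ_L̲ = H_u² - H_n²`.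
* *Regularity fields.* The tube map `F = uncurry leaf` is a `C^∞` embedding of the `3`-manifold
  `ℝ × surf`; the leafwise embedding property follows from it but is recorded separately (Mathlib
  lacks `IsImmersion.comp` at the pin); `isSpacelike t` supplies the `C^{n+1}` regularity
  `inducedRiemannianMetric` wants. `𝒯` is timelike because its tangent spaces
  `dF_t(T_y surf) ⊕ ℝ Ḟ` contain the timelike `Ḟ`. The parameter space is all of `ℝ` (the request:
  `F : ℝ × S² → M`); statements about `𝒯_{[t₁, t₂]}` use `portion`.
* *Generality, junk values.* Arbitrary ambient model `I` and regularity `n` (as `hawkingMass`),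
  `2`-dimensional leaves, constants of `dim M = 4`; `timelikeTubeEnergyFlux` is the `Spacetime 4`
  specialisation. `surf : Type` puts `TimelikeTube g τ` in `Type 1` (as `BondiFoliation`). Junk
  values are those of `hawkingMass` (none for `C¹` null normals on a compact leaf).
* *Not here.* BHMS Lemma 3 as a Lean statement; the identification of `lim m_H` with the Bondi
  mass of a cut (the Bondi vocabulary over `CauchyDevelopment` is `BondiSachsRadiativeEnd.lean`,
  whose `tendsto_sectionHawkingMass` feeds `tendsto_energyFlux`; not imported here); the Wang–Yau
  energy.

## References

* S. W. Hawking, *Gravitational radiation in an expanding universe*, J. Math. Phys. 9 (1968) 598.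
* H. Bray, S. Hayward, M. Mars, W. Simon, *Generalized inverse mean curvature flows in spacetime*,
  Comm. Math. Phys. 272 (2007) 119–138, §2 (flows `Φ : Ŝ × I → V`, eq. (1), Lemma 3), §3 Thm 1.
* S. A. Hayward, *Energy conservation for dynamical black holes*, Phys. Rev. Lett. 93 (2004)
  251101 (Hawking energy `E`, flux `ψ`, `Θ_{±±} = |σ_±|²/32π`, `[E] = ∫_H (T + Θ)(χ, τ) d²A dx`).
* S. A. Hayward, *Quasilocal gravitational energy*, Phys. Rev. D 49 (1994) 831–839, §5.
* M.-T. Wang, S.-T. Yau, Phys. Rev. Lett. 102 (2009) 021101, §2; Comm. Math. Phys. 288 (2009)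
  919–942 (rendering (a), not formalised).
* D. Christodoulou, S. Klainerman, *The global nonlinear stability of the Minkowski space*,
  Princeton 1993, Ch. 17, 17.0.3 and 17.0.8; H. Bondi, M. van der Burg, A. Metzner, Proc. Roy.
  Soc. A 269 (1962) 21, §5.
-/

noncomputable section

open Bundle Set Manifold TopologicalSpace Filter MeasureTheory Real Function
open scoped ContDiff Topology ENNReal Manifold

namespace Literature.Geometry.Lorentzian

variable {E : Type*} [NormedAddCommGroup E] [NormedSpace ℝ E] {H : Type*} [TopologicalSpace H]
  {I : ModelWithCorners ℝ E H} {M : Type*} [TopologicalSpace M] [ChartedSpace H M]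
  [IsManifold I ∞ M] {n : ℕ∞ω}

namespace LorentzianMetric

/-! ### The Hawking mass as a function of area and `∫ θ_L θ_L̲`; scale covariance -/

/-- The **Hawking mass as a function of the area `A = |S|` and of the integral
`J = ∫_S θ_L θ_L̲ dA`**: `hawkingMassFormula A J = √(A / 16π) · (1 + (16π)⁻¹ J)`
(`hawkingMass` is literally this expression, `hawkingMass_eq_hawkingMassFormula`). Isolating the
two arguments makes the scaling behaviour visible: `J` is scale invariant and `A` has the
dimension of an area (`hawkingMassFormula_sq_mul`). Hawking, J. Math. Phys. 9 (1968) 598, §3;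
Bray–Hayward–Mars–Simon, CMP 272 (2007), eq. (1). [cite: BrayHaywardMarsSimon2007, eq. (1)] -/
def hawkingMassFormula (A J : ℝ) : ℝ :=
  √(A / (16 * π)) * (1 + (16 * π)⁻¹ * J)

/-- **Scale covariance of the Hawking mass.** Under a constant rescaling `g ↦ c² g` (`c ≥ 0`) of
the spacetime metric, with the null normal pair rescaled to `(c⁻¹ L, c⁻¹ L̲)` so as to keep
`g(L, L̲) = -2`, the area scales as `|S| ↦ c² |S|` while `θ_L θ_L̲ dA` is invariant; hence
`m_H ↦ c · m_H` — the Hawking mass, and with it the Hawking-mass flux, has the dimension of an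
energy (length, `G = c = 1`). Stated on the formula: `hawkingMassFormula (c² A) J =
c · hawkingMassFormula A J`. Hawking 1968, §3; BHMS 2007, eq. (1). [folklore] -/
lemma hawkingMassFormula_sq_mul (c A J : ℝ) (hc : 0 ≤ c) :
    hawkingMassFormula (c ^ 2 * A) J = c * hawkingMassFormula A J := by
  unfold hawkingMassFormula
  rw [mul_div_assoc, Real.sqrt_mul (sq_nonneg c), Real.sqrt_sq hc, mul_assoc]

section Formula

variable {E'' : Type*} [NormedAddCommGroup E''] [NormedSpace ℝ E''] {H'' : Type*}
  [TopologicalSpace H''] {I'' : ModelWithCorners ℝ E'' H''} {S : Type*} [TopologicalSpace S]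
  [ChartedSpace H'' S] [FiniteDimensional ℝ E]
  [FiniteDimensional ℝ E''] [IsManifold I'' ∞ S] [CompactSpace S] [T2Space S] [MeasurableSpace S]
  [BorelSpace S] (g : LorentzianMetric I n M) [g.HasLeviCivita] {τ : TimeOrientation g} (f : S → M)

/-- The Hawking mass is `hawkingMassFormula` evaluated at the area `|S|` and the integral
`∫_S θ_L θ_L̲ dA` (by definition of `hawkingMass`). Hawking 1968, §3. [folklore] -/
lemma hawkingMass_eq_hawkingMassFormula
    (hpb : PseudoRiemannianMetric.contMDiff_pullbackBilin I M I'' S n)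
    (hf : g.IsSpacelikeImmersion I'' f) (P : NullNormalPair I'' g τ f) :
    g.hawkingMass f hpb hf P =
      hawkingMassFormula (totalArea (g.inducedRiemannianMetric f hpb hf)).toReal
        (∫ y, g.nullExpansion f hpb hf P.L y * g.nullExpansion f hpb hf P.Lbar y
          ∂(riemannianVolume (g.inducedRiemannianMetric f hpb hf) 2)) :=
  rfl

end Formula

/-! ### Timelike tubes foliated by closed spacelike surfaces -/

variable (g : LorentzianMetric I n M) (τ : TimeOrientation g)

/-- Hypothesis structure: a **timelike tube** `𝒯 ≅ ℝ × S` in the time-oriented Lorentzian manifold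
`(M, g, τ)`, foliated by closed spacelike surfaces — the timelike boundary `³B` foliated by
`Σ_t = ∂Ω_t` of the Brown–York / Wang–Yau set-up (Wang–Yau, PRL 102 (2009) 021101, §2), the image
of a flow of spacelike `2`-surfaces `Φ : Ŝ × I → V` in the sense of Bray–Hayward–Mars–Simon, CMP
272 (2007), §2, with timelike flow vector. It bundles

* the surface type `surf` (a compact Hausdorff smooth `2`-manifold modelled on
  `EuclideanSpace ℝ (Fin 2)` with its Borel measurable structure; the seven instances are fields,
  made instances below, exactly as in `BondiFoliation`), and the smoothness fact `hpb` for
  pullbacks of bilinear forms to `surf` (a named fact of `Isometry.lean`, as for `inducedMetric`);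
* the leaves `leaf t : surf → M` (`S_t := leaf t (surf)`), such that the tube map
  `F : ℝ × surf → M`, `F(t, y) = leaf t y`, is a smooth embedding of the `3`-manifold `ℝ × surf`;
* each leaf is a smooth embedding and a spacelike immersion (the former follows from the
  embedding property of `F`; it is recorded separately, see the module docstring);
* every flow line `t ↦ leaf t y` is a future-directed timelike curve (so `𝒯 = range F` is a
  timelike hypersurface — its tangent spaces `dF_t(T_y surf) ⊕ ℝ Ḟ` contain a timelike vector —
  and increasing `t` is the future);
* a null normal pair `pair t = (L, L̲)`, `g(L, L̲) = -2`, of each leaf (the datum `hawkingMass`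
  consumes; the Hawking mass of `S_t` does not depend on this choice, see the module docstring).

No field relates to an "interior" of the tube; meant for `dim M = 4`. [cite: BrayHaywardMarsSimon2007, §2] -/
structure TimelikeTube where
  /-- The surface type of the leaves. -/
  surf : Type
  /-- Topology of the surface type. -/
  [top : TopologicalSpace surf]
  /-- The surface type is a `2`-manifold. -/
  [charted : ChartedSpace (EuclideanSpace ℝ (Fin 2)) surf]
  /-- The surface type is a smooth manifold. -/
  [mfd : IsManifold (𝓡 2) ∞ surf]
  /-- The surface type is compact (closed surfaces). -/
  [compact : CompactSpace surf]
  /-- The surface type is Hausdorff. -/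
  [t2 : T2Space surf]
  /-- Measurable structure of the surface type (for areas and integrals). -/
  [meas : MeasurableSpace surf]
  /-- The measurable structure is the Borel one. -/
  [borel : BorelSpace surf]
  /-- The smoothness fact for pullbacks of bilinear forms along maps `surf → M`. -/
  hpb : PseudoRiemannianMetric.contMDiff_pullbackBilin I M (𝓡 2) surf n
  /-- The leaves `S_t = leaf t : surf → M` of the tube. -/
  leaf : ℝ → surf → M
  /-- The tube map `(t, y) ↦ leaf t y` is a smooth embedding of `ℝ × surf` into `M`. -/
  isSmoothEmbedding_uncurry :
    Manifold.IsSmoothEmbedding (𝓘(ℝ, ℝ).prod (𝓡 2)) I ∞ (Function.uncurry leaf)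
  /-- Each leaf is a smooth embedding. -/
  isSmoothEmbedding (t : ℝ) : Manifold.IsSmoothEmbedding (𝓡 2) I ∞ (leaf t)
  /-- Each leaf is a spacelike immersion. -/
  isSpacelike (t : ℝ) : g.IsSpacelikeImmersion (𝓡 2) (leaf t)
  /-- Every flow line `t ↦ leaf t y` is a future-directed timelike curve. -/
  isFutureTimelike (y : surf) : g.IsFutureTimelikeCurveOn τ (fun t ↦ leaf t y) univ
  /-- A null normal pair `(L, L̲)` of each leaf. -/
  pair (t : ℝ) : NullNormalPair (𝓡 2) g τ (leaf t)

namespace TimelikeTube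

attribute [instance] top charted mfd compact t2 meas borel

variable {g τ} (𝓣 : TimelikeTube g τ)

/-- The **tube map** `F : ℝ × surf → M`, `F(t, y) = leaf t y` (whose image is the timelike
hypersurface `𝒯`). BHMS 2007, §2 (the flow `Φ`). [cite: BrayHaywardMarsSimon2007, §2] -/
def map : ℝ × 𝓣.surf → M :=
  Function.uncurry 𝓣.leaf

/-- `F(t, y) = leaf t y`. [folklore] -/
@[simp]
lemma map_apply (t : ℝ) (y : 𝓣.surf) : 𝓣.map (t, y) = 𝓣.leaf t y :=
  rfl

/-- The tube map is injective (distinct leaves are disjoint and each leaf is embedded).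
[folklore] -/
lemma injective_map : Injective 𝓣.map :=
  𝓣.isSmoothEmbedding_uncurry.isEmbedding.injective

/-- The tube map is continuous. [folklore] -/
lemma continuous_map : Continuous 𝓣.map :=
  𝓣.isSmoothEmbedding_uncurry.isEmbedding.continuous

/-- Distinct leaves of a timelike tube are disjoint. [folklore] -/
lemma disjoint_range_leaf {t₁ t₂ : ℝ} (h : t₁ ≠ t₂) :
    Disjoint (range (𝓣.leaf t₁)) (range (𝓣.leaf t₂)) := by
  refine disjoint_left.mpr ?_
  rintro _ ⟨y₁, rfl⟩ ⟨y₂, hy⟩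
  have := 𝓣.injective_map (a₁ := (t₂, y₂)) (a₂ := (t₁, y₁)) (by simpa using hy)
  exact h (Prod.ext_iff.mp this).1.symm

/-- The velocity of the flow line through `leaf t y` is timelike. [folklore] -/
lemma isTimelike_velocity (t : ℝ) (y : 𝓣.surf) :
    g.IsTimelike (velocity I (fun s ↦ 𝓣.leaf s y) t) :=
  (𝓣.isFutureTimelike y t (mem_univ t)).2.1

/-- The velocity of the flow line through `leaf t y` is future-directed. [folklore] -/
lemma isFutureDirected_velocity (t : ℝ) (y : 𝓣.surf) :
    τ.IsFutureDirected (velocity I (fun s ↦ 𝓣.leaf s y) t) :=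
  (𝓣.isFutureTimelike y t (mem_univ t)).2.2

/-- The **portion** `𝒯_{[t₁, t₂]} = F([t₁, t₂] × surf) = ⋃_{t ∈ [t₁, t₂]} S_t` of the tube between
the cuts `S_{t₁}` and `S_{t₂}` (empty if `t₂ < t₁`). Wang–Yau, PRL 102 (2009) 021101, §2 (`³B`
between `Σ_{t'}` and `Σ_{t''}`). [cite: WangYau2009PRL, §2] -/
def portion (t₁ t₂ : ℝ) : Set M :=
  𝓣.map '' (Icc t₁ t₂ ×ˢ univ)

/-- Each leaf `S_t`, `t ∈ [t₁, t₂]`, lies in the portion `𝒯_{[t₁, t₂]}`. [folklore] -/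
lemma range_leaf_subset_portion {t t₁ t₂ : ℝ} (ht : t ∈ Icc t₁ t₂) :
    range (𝓣.leaf t) ⊆ 𝓣.portion t₁ t₂ := by
  rintro _ ⟨y, rfl⟩
  exact ⟨(t, y), ⟨ht, mem_univ y⟩, rfl⟩

/-- The portion lies in the tube `𝒯 = range F`. [folklore] -/
lemma portion_subset_range (t₁ t₂ : ℝ) : 𝓣.portion t₁ t₂ ⊆ range 𝓣.map :=
  image_subset_range _ _

/-- A tube portion between two cuts is compact (the leaves are closed surfaces). [folklore] -/
lemma isCompact_portion (t₁ t₂ : ℝ) : IsCompact (𝓣.portion t₁ t₂) :=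
  (isCompact_Icc.prod isCompact_univ).image 𝓣.continuous_map

section Mass

variable [FiniteDimensional ℝ E]

/-- The induced Riemannian metric `(leaf t)^* g` of the leaf `S_t`. [folklore] -/
def leafMetric (t : ℝ) :
    ContMDiffRiemannianMetric (𝓡 2) n (EuclideanSpace ℝ (Fin 2))
      (TangentSpace (𝓡 2) : 𝓣.surf → Type _) :=
  g.inducedRiemannianMetric (𝓣.leaf t) 𝓣.hpb (𝓣.isSpacelike t)

/-- The **area** `|S_t|` of the leaf `S_t` (total `2`-dimensional Riemannian volume of the induced
metric, `totalArea` of `Volume.lean`). BHMS 2007, §1. [cite: BrayHaywardMarsSimon2007, §1] -/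
def leafArea (t : ℝ) : ℝ≥0∞ :=
  totalArea (𝓣.leafMetric t)

variable [g.HasLeviCivita]

/-- The **Hawking mass `m_H(S_t)`** of the leaf `S_t` of a timelike tube (w.r.t. its null normal
pair `pair t`; `LorentzianMetric.hawkingMass`). Hawking, J. Math. Phys. 9 (1968) 598, §3; BHMS
2007, eq. (1) (`M_H(λ) ≡ M_H(S_λ)`). [cite: BrayHaywardMarsSimon2007, eq. (1)] -/
def leafHawkingMass (t : ℝ) : ℝ :=
  g.hawkingMass (𝓣.leaf t) 𝓣.hpb (𝓣.isSpacelike t) (𝓣.pair t)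

/-- The **Hawking-mass (Hawking-energy) flux** through the portion `𝒯_{[t₁, t₂]}` of a timelike
tube: `Φ(t₁, t₂) = m_H(S_{t₁}) - m_H(S_{t₂})`, the net quasi-local energy radiated *outward*
through the tube between the cuts `S_{t₁}` (earlier) and `S_{t₂}` (later); equivalently
`-∫_{t₁}^{t₂} (d/dt) m_H(S_t) dt` (`energyFlux_eq_neg_intervalIntegral`), whose integrand — an
integral over `S_t` of Einstein-tensor, Hawking-energy-density and gravitational-radiation
(`Θ^T ∝ |σ_±|²`, `Θ^L ∝ |ζ|²`) densities — is the variation formula of Bray–Hayward–Mars–Simon,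
CMP 272 (2007), Lemma 3, for an arbitrary flow of spacelike `2`-surfaces (energy interpretation:
Remark after Thm 1; Hayward, PRL 93 (2004) 251101, `[E] = ∫_H (T + Θ)(χ, τ) d²A dx`). A net flux,
unsigned in general; nonnegative along flows on which `m_H` is non-increasing
(`energyFlux_nonneg_of_antitoneOn`) and, for cuts receding to `𝓘⁺`, convergent to the Bondi mass
loss (`tendsto_energyFlux`; Hayward, PRD 49 (1994) 831, §5). Scales like an energy
(`hawkingMassFormula_sq_mul`). [cite: BrayHaywardMarsSimon2007, §2 Lemma 3 and §3 Remark after Thm 1] -/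
def energyFlux (t₁ t₂ : ℝ) : ℝ :=
  𝓣.leafHawkingMass t₁ - 𝓣.leafHawkingMass t₂

/-- Unfolding lemma: `Φ(t₁, t₂) = m_H(S_{t₁}) - m_H(S_{t₂})`. [folklore] -/
lemma energyFlux_def (t₁ t₂ : ℝ) :
    𝓣.energyFlux t₁ t₂ = 𝓣.leafHawkingMass t₁ - 𝓣.leafHawkingMass t₂ :=
  rfl

/-- No energy flows through a portion of zero duration: `Φ(t, t) = 0`. [folklore] -/
@[simp]
lemma energyFlux_self (t : ℝ) : 𝓣.energyFlux t t = 0 :=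
  sub_self _

/-- **Additivity** of the flux under concatenation of tube portions:
`Φ(t₁, t₂) + Φ(t₂, t₃) = Φ(t₁, t₃)`. Hayward 2004 (integral form of the first law). [folklore] -/
@[simp]
lemma energyFlux_add_energyFlux (t₁ t₂ t₃ : ℝ) :
    𝓣.energyFlux t₁ t₂ + 𝓣.energyFlux t₂ t₃ = 𝓣.energyFlux t₁ t₃ := by
  simp only [energyFlux]
  ring

/-- Reversing the portion reverses the sign of the flux: `Φ(t₂, t₁) = -Φ(t₁, t₂)`. [folklore] -/
lemma energyFlux_symm (t₁ t₂ : ℝ) : 𝓣.energyFlux t₂ t₁ = -𝓣.energyFlux t₁ t₂ := by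
  simp only [energyFlux]
  ring

/-- **Balance law (P2), exact for the Hawking mass**: the increment of the quasi-local mass
between the cuts is minus the flux through the tube portion between them,
`m_H(S_{t₂}) - m_H(S_{t₁}) = -Φ(t₁, t₂)` (Hayward, PRL 93 (2004) 251101: `[E]`, the change of the
Hawking energy from one surface to another, is the integrated flux). [cite: Hayward2004, integral forms of the first law] -/
lemma leafHawkingMass_sub_eq_neg_energyFlux (t₁ t₂ : ℝ) :
    𝓣.leafHawkingMass t₂ - 𝓣.leafHawkingMass t₁ = -𝓣.energyFlux t₁ t₂ := by
  simp only [energyFlux]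
  ring

/-- **The flux is minus the time integral of the rate of change of the Hawking mass**:
if `t ↦ m_H(S_t)` has derivative `m' t` on `[t₁, t₂]` and `m'` is integrable there, then
`Φ(t₁, t₂) = -∫_{t₁}^{t₂} m' t dt` (FTC; the integrand is BHMS 2007, Lemma 3 — the Einstein-tensor,
Hawking-energy-density and gravitational-radiation (`|σ_±|²`, `|ζ|²`) terms integrated over `S_t`).
[cite: BrayHaywardMarsSimon2007, Lemma 3] -/
theorem energyFlux_eq_neg_intervalIntegral {t₁ t₂ : ℝ} (m' : ℝ → ℝ)
    (hderiv : ∀ t ∈ uIcc t₁ t₂, HasDerivAt 𝓣.leafHawkingMass (m' t) t)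
    (hint : IntervalIntegrable m' volume t₁ t₂) :
    𝓣.energyFlux t₁ t₂ = -∫ t in t₁..t₂, m' t := by
  rw [intervalIntegral.integral_eq_sub_of_hasDerivAt hderiv hint, energyFlux, neg_sub]

/-- The flux through `𝒯_{[t₁, t₂]}` is nonnegative iff the Hawking mass has not increased:
`0 ≤ Φ(t₁, t₂) ↔ m_H(S_{t₂}) ≤ m_H(S_{t₁})`. [folklore] -/
lemma energyFlux_nonneg_iff (t₁ t₂ : ℝ) :
    0 ≤ 𝓣.energyFlux t₁ t₂ ↔ 𝓣.leafHawkingMass t₂ ≤ 𝓣.leafHawkingMass t₁ :=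
  sub_nonneg

/-- **Monotone flows have signed flux** (hypothesis form of Bray–Hayward–Mars–Simon 2007, Thm 1,
read in the time-reversed direction, and of Bondi mass loss): if `t ↦ m_H(S_t)` is non-increasing
on `[t₁, t₂]`, `t₁ ≤ t₂`, the outgoing flux is nonnegative. [cite: BrayHaywardMarsSimon2007, Thm 1] -/
lemma energyFlux_nonneg_of_antitoneOn {t₁ t₂ : ℝ} (ht : t₁ ≤ t₂)
    (h : AntitoneOn 𝓣.leafHawkingMass (Icc t₁ t₂)) : 0 ≤ 𝓣.energyFlux t₁ t₂ :=
  (𝓣.energyFlux_nonneg_iff t₁ t₂).mpr (h (left_mem_Icc.mpr ht) (right_mem_Icc.mpr ht) ht)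

/-- **(P1), foliation-agnostic form: convergence of the flux from convergence of the Hawking
masses of the cuts.** For a family of timelike tubes `𝓣 i` with cuts at parameters `t₁ i`, `t₂ i`
whose Hawking masses converge along a filter `l` to `m₁` resp. `m₂` — e.g. cuts receding to null
infinity along two outgoing null hypersurfaces `C_{u₁}`, `C_{u₂}`, where the limits are the Bondi
masses `M_B(u₁)`, `M_B(u₂)` (Hayward, PRD 49 (1994) 831, §5: `M_B = lim M_H`; Christodoulou–
Klainerman 1993, 17.0.3) — the fluxes converge to `m₁ - m₂` (there: the Bondi–Trautman mass loss
`M_B(u₁) - M_B(u₂) ≥ 0`, Hayward 2004: "`ψ` reduces to the Bondi flux at null infinity"); in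
the tree the hypotheses are supplied by `BondiSachsRadiativeEnd.tendsto_sectionHawkingMass` and the
sign by `BondiSachsRadiativeEnd.bondiMass_antitoneOn` (`BondiSachsRadiativeEnd.lean`).
[cite: Hayward1994, §5] -/
theorem tendsto_energyFlux {ι : Type*} {l : Filter ι} (𝓣 : ι → TimelikeTube g τ)
    (t₁ t₂ : ι → ℝ) {m₁ m₂ : ℝ}
    (h₁ : Tendsto (fun i ↦ (𝓣 i).leafHawkingMass (t₁ i)) l (𝓝 m₁))
    (h₂ : Tendsto (fun i ↦ (𝓣 i).leafHawkingMass (t₂ i)) l (𝓝 m₂)) :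
    Tendsto (fun i ↦ (𝓣 i).energyFlux (t₁ i) (t₂ i)) l (𝓝 (m₁ - m₂)) :=
  h₁.sub h₂

/-- The Hawking mass of a leaf in terms of its area and `∫ θ_L θ_L̲` (`hawkingMassFormula`), whence
the scaling `m_H ↦ c m_H`, `Φ ↦ c Φ` under `g ↦ c² g` (`hawkingMassFormula_sq_mul`). [folklore] -/
lemma leafHawkingMass_eq_hawkingMassFormula (t : ℝ) :
    𝓣.leafHawkingMass t =
      hawkingMassFormula (𝓣.leafArea t).toReal
        (∫ y, g.nullExpansion (𝓣.leaf t) 𝓣.hpb (𝓣.isSpacelike t) (𝓣.pair t).L y *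
            g.nullExpansion (𝓣.leaf t) 𝓣.hpb (𝓣.isSpacelike t) (𝓣.pair t).Lbar y
          ∂(riemannianVolume (𝓣.leafMetric t) 2)) :=
  rfl

end Mass

end TimelikeTube

end LorentzianMetric

/-! ### The requested form: spacetimes of dimension `4` -/

/-- **Energy flux through a timelike tube in a `4`-dimensional spacetime** (definition request
`timelikeTubeEnergyFlux` of route `FinalStateConjecture/ConcentrationCannotWait`, no-loitering
lemma NL and lump bookkeeping K3): for `𝓢 : Spacetime 4` with its Levi-Civita connection and a
timelike tube `𝓣` (an embedded cylinder `ℝ × surf ↪ 𝓢` foliated by closed spacelike `2`-surfaces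
`S_t` with future-timelike flow lines, `LorentzianMetric.TimelikeTube`), the Hawking-mass flux
`m_H(S_{t₁}) - m_H(S_{t₂})` through the portion between the cuts `S_{t₁}` and `S_{t₂}`
(`TimelikeTube.energyFlux`, rendering (b): Hawking 1968; Bray–Hayward–Mars–Simon 2007, Lemma 3;
Hayward 2004). Properties: balance law `leafHawkingMass_sub_eq_neg_energyFlux` (exact),
asymptotics `tendsto_energyFlux`, scaling `hawkingMassFormula_sq_mul` (an energy: `Φ ↦ c Φ`
under `g ↦ c² g`). [cite: BrayHaywardMarsSimon2007, §2 Lemma 3] -/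
abbrev timelikeTubeEnergyFlux (𝓢 : Spacetime 4) [𝓢.metric.HasLeviCivita]
    (𝓣 : 𝓢.metric.TimelikeTube 𝓢.timeOrientation) (t₁ t₂ : ℝ) : ℝ :=
  𝓣.energyFlux t₁ t₂

/-- Unfolding lemma: `timelikeTubeEnergyFlux 𝓢 𝓣 t₁ t₂ = m_H(S_{t₁}) - m_H(S_{t₂})`. [folklore] -/
lemma timelikeTubeEnergyFlux_eq (𝓢 : Spacetime 4) [𝓢.metric.HasLeviCivita]
    (𝓣 : 𝓢.metric.TimelikeTube 𝓢.timeOrientation) (t₁ t₂ : ℝ) :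
    timelikeTubeEnergyFlux 𝓢 𝓣 t₁ t₂ = 𝓣.leafHawkingMass t₁ - 𝓣.leafHawkingMass t₂ :=
  rfl

end Literature.Geometry.Lorentzian

end
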